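import Summits.QuantumFields.YangMills.Theorems.BalabanUVNodesN12FlatIterAxialHnd
import Summits.QuantumFields.YangMills.Theorems.BalabanUVNodesN12FlatFibreNullSpaceDetSet
import HarnessLib

/-!
# BalabanUVNodes ∕ N12 — (β)♭ FOR A GENERAL DETERMINING SET IN PRINT's ITERATED AXIAL GAUGE: the whole-lattice linearised `Ax_k` ([Balaban1985RegularSpaces] (1.19)) is transversal to the
# LOCALLY-CONSTANT flat null space of EVERY determining set whose constrained bonds cross all `k`-block faces (letter (F)); hence the nondegeneracy ∕ positivity letter at NODE 00's flat
# multi-scale chart for such `𝐁` holds modulo the two GEOMETRIC letters (L), (F) only — no slice letter and no connectivity letter (C); AND print's `𝐁`-ADAPTED hierarchical axial slice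
# ([III] (2.13): axial inside each region's block towers from its own scale) is transversal to the same space modulo a coverage letter (Cov) and the connectivity letter (C)

Cell `pub-ymgap` (HUMAN RULINGS D-0062 ∕ D-0149), WIDTH SEAT `pub-ymgap-dag-n12-w3` g2 (node N12 = [B15]; key K1⁷ `stmt-QuantumFields-20542`, `--kind proof --supports … --as helper`;
count-neutral).  THEOREMS ONLY (0 `def`, 0 `instance`, 0 `sorry`); every input CONSUMED BY NAME: this seat's `N12FlatFibreNullSpaceDetSet.eq_zero_of_fderiv_msChart_one_eq_zero_of_transversal_detSet`,
`N12FlatIterAxialHnd.axialT_ofAdd_grad_eq_one_iff`, `N12FlatIterAxialRepr.iterBlockOf_embIter_eq_of_lt`, `N12FlatFibreNullSpace.const_of_shift_eq`, `N12FlatChartHnd.deriv_deriv_wilsonAction4_expChart_one_nonneg`;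
the route UnitScaleTilt's `Prop7AvgLinearisation.iterLin_grad`, `B10Eq27TorusAxialLog.axialT`; `BIJ88RT51Background.iterBlockOf_embIter`.

WHY.  `N12FlatFibreNullSpaceDetSet` identifies the flat null space on the joint kernel of a multi-level `𝐁` as `{dφ : φ locally constant on the constrained-centre graph}` (modulo (L)), and
reduces it to `Lie (4)` only under the connectivity letter (C) (at the record a consequence of the nestedness of the maximal sequence: the level-`(n+1)` constrained bonds reach the OUTER
neighbours of `Γ_{n+1}`, whose centres lie in the shell `Γ_n` — NODE 00 geometry, not typed).  This file gives the route that needs NEITHER (C) NOR a separately displayed slice letter: in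
print's own gauge — the iterated axial gauge `Ax_k`, here imposed on the whole lattice — an iterated-axial pure gauge is constant on `k`-blocks (§1), and the constrained bonds crossing the
`k`-block faces (letter (F): for every `k`-site `w` and direction `μ` some constrained bond `(j, c)`, `j ≤ k`, has the `j`-fold centres of its ends in the `k`-blocks `w` and `w + e_μ` — at the
record: the regions of an admissible sequence are unions of blocks of their own scale and cover the torus) tie the block constants together, so the slice is transversal to the whole
locally-constant null space.

CONTENTS (two namespaces: `…N12FlatIterAxialHndDetSet` for the whole-lattice `Ax_k`, `…N12FlatHierAxialHndDetSet` for print's `𝐁`-ADAPTED hierarchical gauge).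
§1 ★★ `eq_centre_of_iterAxial` (`dφ` iterated-axial below `k` ⟹ `φ(z) = φ(embIter k (iterBlockOf k z))`, `k ≤ m + K`), ★★★ `grad_eq_zero_of_iterAxial_of_locConst` (transversality of `Ax_k` to the
   locally-constant null space, modulo (F)).
§2 at NODE 00's objects, general `𝐁`, modulo (L) and (F): ★★★ `eq_zero_of_fderiv_msChart_one_eq_zero_of_iterAxial_detSet`, ★★ `deriv_deriv_pos_of_fderiv_msChart_one_eq_zero_of_iterAxial_detSet`.
Second namespace — PRINT's `𝐁`-ADAPTED SLICE ([III] (2.13) ∕ [Balaban1985RegularSpaces] (1.19) region by region: for every member site `y ∈ Γ_j` and every site `x` of level `m < j` in the block tower of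
`y` — `iterBlockOf j (embIter m x) = y` — the level-`m` field `Q^{(m)}X` is axial along the one-level comb from the centre of the block of `x`; this is the slice an IFT at a multi-level `𝐁`
should use, since it is large enough for the `honto` letter):
§3 `iterBlockOf_embIter_iterBlockOf` (nested blocks: the `m`-fold centre of the `m`-block of `z` has the same `j`-block as `z`, `m ≤ j ≤ m + K`), ★★ `eq_top_of_hierAxial_under` (descent under a top:
   `iterBlockOf j z = y ⟹ φ z = φ(embIter j y)`), ★★★ `grad_eq_zero_of_hierAxial_of_locConst` (TRANSVERSALITY of the `𝐁`-adapted slice to the locally-constant null space modulo the coverage letter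
   (Cov) «every fine site lies in the block tower of some member site» and the connectivity letter (C));
§4 at NODE 00's objects, general `𝐁`, modulo (L), (Cov), (C): ★★★ `eq_zero_of_fderiv_msChart_one_eq_zero_of_hierAxial_detSet`, ★★ `deriv_deriv_pos_of_fderiv_msChart_one_eq_zero_of_hierAxial_detSet`.
§5 sanity: `hface_atScale`, `hcov_atScale` — the whole-lattice constraint satisfies (F) and (Cov) (with `N12FlatFibreNullSpaceDetSet.hloop_atScale ∕ hconn_atScale`: all four letters hold for `atScale k`).
(The letters (L) and (Cov) are DISCHARGED for the record's `𝐁_k(Z)` in the companion `BalabanUVNodesN12FlatHndRecordLetters`.)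

HONEST FRAMING.  Flat configuration only; the geometric letters (L), (F), (Cov), (C) are DISPLAYED here ((L) and (Cov) are proved for the record's `𝐁_k(Z)` in the companion
`BalabanUVNodesN12FlatHndRecordLetters`; (F) and (C) are not proved for NODE 00's `Bj`); the
whole-lattice `Ax_k` is used as the slice — a SMALLER slice than print's `𝐁`-adapted hierarchical axial gauge (axial inside each region's block towers from ITS OWN scale down), so this
transversality is the weaker statement and, when `𝐁` has members below `k`, the whole-lattice slice is in general too small for the companion `honto` letter (it need not meet every fibre of
`DΦ(0)`); the `𝐁`-adapted slice (transversal modulo a coverage letter and (C)) is the one an IFT at a multi-level `𝐁` should use — separate file; no constants; nothing of Bałaban's estimates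
asserted; N12 NOT discharged; K1⁷ NOT closed; counts unmoved (typed 28∕28 · discharged 5∕27); one finite 𝕋⁴ programme at fixed ε — R4 closes the conditional rung
`BalabanLadder.UV` only; the Yang–Mills mass gap (Clay) is NOT proved by any of this; nothing continuum ∕ ℝ⁴ ∕ OS.
-/

noncomputable section

namespace Summit.QuantumFields.YangMills.BalabanUVNodes.N12FlatIterAxialHndDetSet

open scoped BigOperators Matrix.Norms.L2Operator Topology
open Literature.MathematicalPhysics.QuantumFieldTheory.Balaban1983to89
open T4Continuum (T4Family)
open BlockAveragingEMLLinearised (linAvg)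
open T4AdjointCovarianceUnitary (lieSU)
open B15DeterminingSets
open B5Eq118OneStroke (iterBlockOf)
open B10Eq27TorusAxialLog (axialT)
open Node00
open Literature.MathematicalPhysics.QuantumFieldTheory.BalabanImbrieJaffe1984to88.BIJ88RT51Background (iterBlockOf_embIter)
open Summit.QuantumFields.YangMills.Theorems.Prop7AvgLinearisation (iterLin_grad)
open Summit.QuantumFields.YangMills.BalabanUVNodes.N12FlatFibreNullSpace (const_of_shift_eq)
open Summit.QuantumFields.YangMills.BalabanUVNodes.N12FlatIterAxialHnd (axialT_ofAdd_grad_eq_one_iff)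
open Summit.QuantumFields.YangMills.BalabanUVNodes.N12FlatIterAxialRepr (iterBlockOf_embIter_eq_of_lt)
open Summit.QuantumFields.YangMills.BalabanUVNodes.N12FlatFibreNullSpaceDetSet
  (eq_zero_of_fderiv_msChart_one_eq_zero_of_transversal_detSet)
open Summit.QuantumFields.YangMills.BalabanUVNodes.N12FlatChartHnd (deriv_deriv_wilsonAction4_expChart_one_nonneg)

/-! ## §1 An iterated-axial pure gauge is constant on `k`-blocks -/

section Blocks

variable {P : Params} {n : Type*} [Fintype n] [DecidableEq n]

omit [Fintype n] [DecidableEq n] in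
/-- **BLOCK-CONSTANCY OF AN ITERATED-AXIAL PURE GAUGE**: if for every `m < k` the level-`m` field `Q^{(m)}(dφ) = d(φ∘embIter m)` is comb-axial along the one-level combs from the centres of the
blocks (the linearised `Ax_k` of [Balaban1985RegularSpaces] (1.19), WITHOUT the centre condition), then `φ` is determined by its values at the `k`-fold centres: `φ(z) = φ(embIter k (iterBlockOf k z))`
(`k ≤ m + K`; downward induction with `iterBlockOf_embIter_eq_of_lt`). [cite: Balaban1985RegularSpaces, (1.19) p.79; Balaban1987RG1, (0.1)-(0.3) pp.251-252] -/
theorem eq_centre_of_iterAxial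
    (Q : (i : ℕ) → (PBond P 0 → Matrix n n ℂ) → PBond P i → Matrix n n ℂ)
    (hQ0 : ∀ Y, Q 0 Y = Y) (hQs : ∀ (i : ℕ) (Y : PBond P 0 → Matrix n n ℂ) (c : PBond P (i + 1)), Q (i + 1) Y c = linAvg (Q i Y) c)
    {k : ℕ} (hk : k ≤ P.m + P.K) (φ : Site P 0 → Matrix n n ℂ)
    (hax : ∀ m, m < k → ∀ x : Site P m,
      axialT (fun b : PBond P m => Multiplicative.ofAdd (Q m (fun e : PBond P 0 => φ e.tgt - φ e.src) b)) (emb (blockOf x)) x = 1)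
    (z : Site P 0) : φ z = φ (embIter k (iterBlockOf k z)) := by
  have hQgrad : ∀ m, Q m (fun e : PBond P 0 => φ e.tgt - φ e.src) = fun b : PBond P m => φ (embIter m b.tgt) - φ (embIter m b.src) := fun m =>
    funext fun b => iterLin_grad Q hQ0 hQs (fun i ψ y => ψ (embIter i y)) (fun ψ => rfl) (fun i ψ y => rfl) φ m b
  -- downward induction: `φ(embIter m x) = φ(embIter k (iterBlockOf k (embIter m x)))` for `m ≤ k`
  have hlevel : ∀ d m : ℕ, m + d = k → ∀ x : Site P m, φ (embIter m x) = φ (embIter k (iterBlockOf k (embIter m x))) := by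
    intro d
    induction d with
    | zero => intro m hm x; rw [add_zero] at hm; subst hm; rw [iterBlockOf_embIter m hk]
    | succ d ih =>
      intro m hm x
      have hmk : m < k := by omega
      have hstep := hax m hmk x
      rw [hQgrad m, axialT_ofAdd_grad_eq_one_iff (fun z : Site P m => φ (embIter m z))] at hstep
      rw [hstep, show embIter m (emb (blockOf x)) = embIter (m + 1) (blockOf x) from rfl, ih (m + 1) (by omega) (blockOf x),
        show embIter (m + 1) (blockOf x) = embIter m (emb (blockOf x)) from rfl, ← iterBlockOf_embIter_eq_of_lt hk hmk x]
  have h0 := hlevel k 0 (zero_add k) z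
  exact h0

omit [Fintype n] [DecidableEq n] in
/-- ★★★ **THE WHOLE-LATTICE ITERATED AXIAL GAUGE `Ax_k` IS TRANSVERSAL TO THE FLAT NULL SPACE OF EVERY DETERMINING SET WHOSE CONSTRAINED BONDS CROSS ALL `k`-BLOCK FACES** (letter (F), DISPLAYED:
for every `k`-site `w` and direction `μ` some constrained bond `(j, c)`, `j ≤ k`, has its two ends' `j`-fold centres in the `k`-blocks `w` and `w + e_μ` — expected for the determining set of an
admissible sequence of block unions covering the torus, NOT proved here): a potential `φ` constant along every constrained bond at the centres (the locally-constant null space of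
`N12FlatFibreNullSpaceDetSet`, with no connectivity letter) whose gradient is iterated-axial is constant, so `dφ = 0`. [cite: Balaban1985RegularSpaces, (1.19) p.79; Balaban1988Convergent, (2.2) p.255, (2.13) pp.256-257] -/
theorem grad_eq_zero_of_iterAxial_of_locConst
    (Q : (i : ℕ) → (PBond P 0 → Matrix n n ℂ) → PBond P i → Matrix n n ℂ)
    (hQ0 : ∀ Y, Q 0 Y = Y) (hQs : ∀ (i : ℕ) (Y : PBond P 0 → Matrix n n ℂ) (c : PBond P (i + 1)), Q (i + 1) Y c = linAvg (Q i Y) c)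
    {k : ℕ} (hk : k ≤ P.m + P.K) (𝔹 : DetSet P)
    (hface : ∀ (w : Site P k) (μ : Fin P.d), ∃ (j : ℕ) (c : PBond P j), j ≤ k ∧ c ∈ bondsOf (𝔹 j) ∧
      iterBlockOf k (embIter j c.src) = w ∧ iterBlockOf k (embIter j c.tgt) = w.shift μ)
    (φ : Site P 0 → Matrix n n ℂ) (hconst : ∀ j, j ≤ k → ∀ c ∈ bondsOf (𝔹 j), φ (embIter j c.tgt) = φ (embIter j c.src))
    (hax : ∀ m, m < k → ∀ x : Site P m,
      axialT (fun b : PBond P m => Multiplicative.ofAdd (Q m (fun e : PBond P 0 => φ e.tgt - φ e.src) b)) (emb (blockOf x)) x = 1) :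
    ∀ b : PBond P 0, φ b.tgt - φ b.src = 0 := by
  have hblk := eq_centre_of_iterAxial Q hQ0 hQs hk φ hax
  -- the centre values agree across every `k`-block face
  have hshift : ∀ (w : Site P k) (μ : Fin P.d), φ (embIter k (w.shift μ)) = φ (embIter k w) := fun w μ => by
    obtain ⟨j, c, hj, hc, hsrc, htgt⟩ := hface w μ
    have h := hconst j hj c hc
    rw [hblk (embIter j c.tgt), hblk (embIter j c.src), hsrc, htgt] at h
    exact h
  have hc := const_of_shift_eq (fun w => φ (embIter k w)) hshift
  intro b
  rw [hblk b.tgt, hblk b.src, hc (iterBlockOf k b.tgt), hc (iterBlockOf k b.src), sub_self]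

end Blocks

/-! ## §2 At NODE 00's objects: (β)♭ for a general determining set in the iterated axial gauge, modulo (L) and (F) -/

section NodeZero

variable {F : T4Family} {N : ℕ} [NeZero N] {K k : ℕ}

/-- ★★★ **`hnd` AT NODE 00's FLAT MULTI-SCALE CHART FOR A GENERAL DETERMINING SET IN THE ITERATED AXIAL GAUGE, MODULO THE GEOMETRIC LETTERS (L) AND (F) ONLY** (no slice letter, no connectivity
letter): `X` iterated-axial below `k` (any recursion family `Q^{(·)}`), `DΦ(0)X = 0` for `Φ = msChart F N K k 𝐁 (M˙1) 1`, `d²∕ds² A(e^{sX})|₀ = 0` ⟹ `X = 0`.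
[cite: Balaban1989LargeFieldII, (1.9) p.358, p.359; Balaban1985RegularSpaces, (1.19) p.79; Balaban1988Convergent, (2.2) p.255, (2.13) pp.256-257] -/
theorem eq_zero_of_fderiv_msChart_one_eq_zero_of_iterAxial_detSet (hk : k ≤ (F.P K).m + (F.P K).K)
    (Q : (i : ℕ) → (PBond (F.P K) 0 → Matrix (Fin N) (Fin N) ℂ) → PBond (F.P K) i → Matrix (Fin N) (Fin N) ℂ)
    (hQ0 : ∀ Y, Q 0 Y = Y) (hQs : ∀ (i : ℕ) (Y : PBond (F.P K) 0 → Matrix (Fin N) (Fin N) ℂ) (c : PBond (F.P K) (i + 1)), Q (i + 1) Y c = linAvg (Q i Y) c)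
    (𝔹 : DetSet (F.P K))
    (hloop : ∀ μ : Fin (F.P K).d, ∃ (j : ℕ) (R : Finset (Site (F.P K) j)), j ≤ k ∧ R.Nonempty ∧ (∀ y ∈ R, y.shift μ ∈ R) ∧
      ∀ y ∈ R, (⟨y, μ⟩ : PBond (F.P K) j) ∈ bondsOf (𝔹 j))
    (hface : ∀ (w : Site (F.P K) k) (μ : Fin (F.P K).d), ∃ (j : ℕ) (c : PBond (F.P K) j), j ≤ k ∧ c ∈ bondsOf (𝔹 j) ∧
      iterBlockOf k (embIter j c.src) = w ∧ iterBlockOf k (embIter j c.tgt) = w.shift μ)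
    {X : PBond (F.P K) 0 → lieSU (Fin N)}
    (hax : ∀ m, m < k → ∀ x : Site (F.P K) m,
      axialT (fun b : PBond (F.P K) m => Multiplicative.ofAdd (Q m (fun e => (X e : Matrix (Fin N) (Fin N) ℂ)) b)) (emb (blockOf x)) x = 1)
    (hker : fderiv ℝ (msChart F N K k 𝔹 (avgFamily (avOfRecord F N K) (1 : GaugeField (F.P K) 0 (SU N))) (1 : GaugeField (F.P K) 0 (SU N))) 0 X = 0)
    (hflat : deriv (deriv fun s : ℝ => wilsonAction4 (expChart (1 : GaugeField (F.P K) 0 (SU N)) (s • X))) 0 = 0) :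
    X = 0 := by
  have hS : ∀ φ : Site (F.P K) 0 → lieSU (Fin N), (∀ j, j ≤ k → ∀ c ∈ bondsOf (𝔹 j), φ (embIter j c.tgt) = φ (embIter j c.src)) →
      (fun b : PBond (F.P K) 0 => φ b.tgt - φ b.src) ∈
        {Y : PBond (F.P K) 0 → lieSU (Fin N) | ∀ m, m < k → ∀ x : Site (F.P K) m,
          axialT (fun b : PBond (F.P K) m => Multiplicative.ofAdd (Q m (fun e => (Y e : Matrix (Fin N) (Fin N) ℂ)) b)) (emb (blockOf x)) x = 1} →
      ∀ b : PBond (F.P K) 0, φ b.tgt - φ b.src = 0 := by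
    intro φ hφ hmem b
    have hmat := grad_eq_zero_of_iterAxial_of_locConst Q hQ0 hQs hk 𝔹 hface (fun z => (φ z : Matrix (Fin N) (Fin N) ℂ))
      (fun j hj c hc => by rw [hφ j hj c hc]) (fun m hm x => by
        have h := hmem m hm x
        simp only [Submodule.coe_sub] at h
        exact h) b
    exact Subtype.ext (by rw [Submodule.coe_sub, hmat, ZeroMemClass.coe_zero])
  exact eq_zero_of_fderiv_msChart_one_eq_zero_of_transversal_detSet 𝔹 hloop hS hax hker hflat

/-- ★★ **POSITIVITY FORM**, general determining set, iterated axial gauge, modulo (L) and (F): `X ≠ 0` iterated-axial with `DΦ(0)X = 0` ⟹ `0 < d²∕ds² A(e^{sX})|₀`.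
[cite: Balaban1989LargeFieldII, (1.9) p.358, p.359; Balaban1985RegularSpaces, (1.19) p.79] -/
theorem deriv_deriv_pos_of_fderiv_msChart_one_eq_zero_of_iterAxial_detSet (hk : k ≤ (F.P K).m + (F.P K).K)
    (Q : (i : ℕ) → (PBond (F.P K) 0 → Matrix (Fin N) (Fin N) ℂ) → PBond (F.P K) i → Matrix (Fin N) (Fin N) ℂ)
    (hQ0 : ∀ Y, Q 0 Y = Y) (hQs : ∀ (i : ℕ) (Y : PBond (F.P K) 0 → Matrix (Fin N) (Fin N) ℂ) (c : PBond (F.P K) (i + 1)), Q (i + 1) Y c = linAvg (Q i Y) c)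
    (𝔹 : DetSet (F.P K))
    (hloop : ∀ μ : Fin (F.P K).d, ∃ (j : ℕ) (R : Finset (Site (F.P K) j)), j ≤ k ∧ R.Nonempty ∧ (∀ y ∈ R, y.shift μ ∈ R) ∧
      ∀ y ∈ R, (⟨y, μ⟩ : PBond (F.P K) j) ∈ bondsOf (𝔹 j))
    (hface : ∀ (w : Site (F.P K) k) (μ : Fin (F.P K).d), ∃ (j : ℕ) (c : PBond (F.P K) j), j ≤ k ∧ c ∈ bondsOf (𝔹 j) ∧
      iterBlockOf k (embIter j c.src) = w ∧ iterBlockOf k (embIter j c.tgt) = w.shift μ)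
    {X : PBond (F.P K) 0 → lieSU (Fin N)} (hX0 : X ≠ 0)
    (hax : ∀ m, m < k → ∀ x : Site (F.P K) m,
      axialT (fun b : PBond (F.P K) m => Multiplicative.ofAdd (Q m (fun e => (X e : Matrix (Fin N) (Fin N) ℂ)) b)) (emb (blockOf x)) x = 1)
    (hker : fderiv ℝ (msChart F N K k 𝔹 (avgFamily (avOfRecord F N K) (1 : GaugeField (F.P K) 0 (SU N))) (1 : GaugeField (F.P K) 0 (SU N))) 0 X = 0) :
    0 < deriv (deriv fun s : ℝ => wilsonAction4 (expChart (1 : GaugeField (F.P K) 0 (SU N)) (s • X))) 0 :=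
  lt_of_le_of_ne (deriv_deriv_wilsonAction4_expChart_one_nonneg X) fun h =>
    hX0 (eq_zero_of_fderiv_msChart_one_eq_zero_of_iterAxial_detSet hk Q hQ0 hQs 𝔹 hloop hface hax hker h.symm)

end NodeZero

end Summit.QuantumFields.YangMills.BalabanUVNodes.N12FlatIterAxialHndDetSet

end

noncomputable section

namespace Summit.QuantumFields.YangMills.BalabanUVNodes.N12FlatHierAxialHndDetSet

open scoped BigOperators Matrix.Norms.L2Operator Topology
open Literature.MathematicalPhysics.QuantumFieldTheory.Balaban1983to89
open T4Continuum (T4Family)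
open BlockAveragingEMLLinearised (linAvg)
open T4AdjointCovarianceUnitary (lieSU)
open B15DeterminingSets
open B5Eq118OneStroke (iterBlockOf iterBlockOf_succ val_iterBlockOf)
open B10Eq27TorusAxialLog (axialT)
open Node00
open Summit.QuantumFields.YangMills.Theorems.Prop7CombGauge (val_embIter_eq)
open Summit.QuantumFields.YangMills.Theorems.Prop7AvgLinearisation (iterLin_grad)
open Summit.QuantumFields.YangMills.BalabanUVNodes.N12FlatIterAxialHnd (axialT_ofAdd_grad_eq_one_iff)
open Summit.QuantumFields.YangMills.BalabanUVNodes.N12FlatFibreNullSpaceDetSet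
  (eq_zero_of_fderiv_msChart_one_eq_zero_of_transversal_detSet)
open Summit.QuantumFields.YangMills.BalabanUVNodes.N12FlatChartHnd (deriv_deriv_wilsonAction4_expChart_one_nonneg)

variable {P : Params}

/-! ## §1 Geometry: the `m`-fold centre of the `m`-block of `z` lies in the same `j`-block as `z` (`m ≤ j`) -/

/-- **Nested blocks**: for `m ≤ j ≤ m + K` and a fine site `z`, the `m`-fold centre of the `m`-block of `z` has the same `j`-block as `z` (labels: `⌊(⌊a/L^m⌋·L^m + off)/L^j⌋ = ⌊a/L^j⌋`).
[cite: Balaban1987RG1, (0.1)-(0.3) pp.251-252] -/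
theorem iterBlockOf_embIter_iterBlockOf {m j : ℕ} (hj : j ≤ P.m + P.K) (hmj : m ≤ j) (z : Site P 0) :
    iterBlockOf j (embIter m (iterBlockOf m z)) = iterBlockOf j z := by
  have hm : m ≤ P.m + P.K := hmj.trans hj
  have hLm : 0 < P.L ^ m := pow_pos P.L_pos m
  funext μ
  apply ZMod.val_injective
  rw [val_iterBlockOf j hj, val_iterBlockOf j hj]
  obtain ⟨off, hoff, hle⟩ := val_embIter_eq m hm (iterBlockOf m z) μ
  rw [hoff, val_iterBlockOf m hm]
  obtain ⟨e, rfl⟩ : ∃ e, j = m + e := ⟨j - m, by omega⟩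
  have hoffL : off < P.L ^ m := by omega
  rw [pow_add, ← Nat.div_div_eq_div_mul, ← Nat.div_div_eq_div_mul, mul_comm ((z μ).val / P.L ^ m) (P.L ^ m), Nat.mul_add_div hLm,
    Nat.div_eq_of_lt hoffL, add_zero]

/-! ## §2 Print's `𝐁`-adapted hierarchical axial slice is transversal to the locally-constant null space (modulo coverage and connectivity) -/

section Transversal

variable {n : Type*} [Fintype n] [DecidableEq n]

omit [Fintype n] [DecidableEq n] in
/-- ★★ **DESCENT UNDER A TOP**: if `dφ` is axial along the one-level combs at every site of every level `m < j` lying under the `j`-block of `y` (the block tower of `y`), then on that tower `φ`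
equals its value at the top: `iterBlockOf j z = y ⟹ φ z = φ (embIter j y)` (`j ≤ m + K`). [cite: Balaban1985RegularSpaces, (1.19) p.79; Balaban1988Convergent, (2.13) pp.256-257] -/
theorem eq_top_of_hierAxial_under
    (Q : (i : ℕ) → (PBond P 0 → Matrix n n ℂ) → PBond P i → Matrix n n ℂ)
    (hQ0 : ∀ Y, Q 0 Y = Y) (hQs : ∀ (i : ℕ) (Y : PBond P 0 → Matrix n n ℂ) (c : PBond P (i + 1)), Q (i + 1) Y c = linAvg (Q i Y) c)
    {j : ℕ} (hj : j ≤ P.m + P.K) (φ : Site P 0 → Matrix n n ℂ) (y : Site P j)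
    (hax : ∀ m, m < j → ∀ x : Site P m, iterBlockOf j (embIter m x) = y →
      axialT (fun b : PBond P m => Multiplicative.ofAdd (Q m (fun e : PBond P 0 => φ e.tgt - φ e.src) b)) (emb (blockOf x)) x = 1)
    {z : Site P 0} (hz : iterBlockOf j z = y) : φ z = φ (embIter j y) := by
  have hQgrad : ∀ m, Q m (fun e : PBond P 0 => φ e.tgt - φ e.src) = fun b : PBond P m => φ (embIter m b.tgt) - φ (embIter m b.src) := fun m =>
    funext fun b => iterLin_grad Q hQ0 hQs (fun i ψ w => ψ (embIter i w)) (fun ψ => rfl) (fun i ψ w => rfl) φ m b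
  -- climb the block tower of `z`: `φ(embIter m (iterBlockOf m z)) = φ(embIter j y)` for `m ≤ j`, by downward induction
  have hlevel : ∀ d m : ℕ, m + d = j → φ (embIter m (iterBlockOf m z)) = φ (embIter j y) := by
    intro d
    induction d with
    | zero => intro m hm; rw [add_zero] at hm; subst hm; rw [hz]
    | succ d ih =>
      intro m hm
      have hmj : m < j := by omega
      have hunder : iterBlockOf j (embIter m (iterBlockOf m z)) = y := by rw [iterBlockOf_embIter_iterBlockOf hj hmj.le, hz]
      have hstep := hax m hmj (iterBlockOf m z) hunder
      rw [hQgrad m, axialT_ofAdd_grad_eq_one_iff (fun w : Site P m => φ (embIter m w))] at hstep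
      rw [hstep, show embIter m (emb (blockOf (iterBlockOf m z))) = embIter (m + 1) (iterBlockOf (m + 1) z) from rfl]
      exact ih (m + 1) (by omega)
  have h0 := hlevel j 0 (zero_add j)
  exact h0

omit [Fintype n] [DecidableEq n] in
/-- ★★★ **PRINT's `𝐁`-ADAPTED HIERARCHICAL AXIAL SLICE IS TRANSVERSAL TO THE LOCALLY-CONSTANT FLAT NULL SPACE, MODULO COVERAGE (Cov) AND CONNECTIVITY (C).**  The slice: for every member site
`y ∈ Γ_j` (`j ≤ k`) and every site `x` of level `m < j` in the block tower of `y`, the level-`m` field `Q^{(m)}X` is axial along the one-level comb from the centre of the block of `x` ([III] (2.13) ∕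
[Balaban1985RegularSpaces] (1.19), region by region from its own scale).  Letters (DISPLAYED): (Cov) every fine site lies in the block tower of some member site `y ∈ Γ_j`, `j ≤ k` (the regions'
blocks cover the torus); (C) a fine site function constant along every constrained bond at the centres takes one value at the sources of any two constrained bonds (connectivity of the
constrained-centre graph).  Then a potential constant along every constrained bond whose gradient lies in the slice is constant: `dφ = 0`.
[cite: Balaban1985RegularSpaces, (1.14) p.78, (1.19) p.79; Balaban1988Convergent, (2.2) p.255, (2.13) pp.256-257] -/
theorem grad_eq_zero_of_hierAxial_of_locConst
    (Q : (i : ℕ) → (PBond P 0 → Matrix n n ℂ) → PBond P i → Matrix n n ℂ)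
    (hQ0 : ∀ Y, Q 0 Y = Y) (hQs : ∀ (i : ℕ) (Y : PBond P 0 → Matrix n n ℂ) (c : PBond P (i + 1)), Q (i + 1) Y c = linAvg (Q i Y) c)
    {k : ℕ} (hk : k ≤ P.m + P.K) (𝔹 : DetSet P)
    (hcov : ∀ z : Site P 0, ∃ j, j ≤ k ∧ iterBlockOf j z ∈ 𝔹 j)
    (hconn : ∀ ψ : Site P 0 → Matrix n n ℂ, (∀ j, j ≤ k → ∀ c ∈ bondsOf (𝔹 j), ψ (embIter j c.tgt) = ψ (embIter j c.src)) →
      ∀ j j', j ≤ k → j' ≤ k → ∀ c ∈ bondsOf (𝔹 j), ∀ c' ∈ bondsOf (𝔹 j'), ψ (embIter j c.src) = ψ (embIter j' c'.src))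
    (φ : Site P 0 → Matrix n n ℂ) (hconst : ∀ j, j ≤ k → ∀ c ∈ bondsOf (𝔹 j), φ (embIter j c.tgt) = φ (embIter j c.src))
    (hax : ∀ j, j ≤ k → ∀ y ∈ 𝔹 j, ∀ m, m < j → ∀ x : Site P m, iterBlockOf j (embIter m x) = y →
      axialT (fun b : PBond P m => Multiplicative.ofAdd (Q m (fun e : PBond P 0 => φ e.tgt - φ e.src) b)) (emb (blockOf x)) x = 1) :
    ∀ b : PBond P 0, φ b.tgt - φ b.src = 0 := by
  -- every fine site takes the value of its top, and all tops agree
  have htop : ∀ z : Site P 0, ∃ (j : ℕ) (y : Site P j), j ≤ k ∧ y ∈ 𝔹 j ∧ φ z = φ (embIter j y) := fun z => by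
    obtain ⟨j, hj, hy⟩ := hcov z
    exact ⟨j, iterBlockOf j z, hj, hy, eq_top_of_hierAxial_under Q hQ0 hQs (hj.trans hk) φ _ (hax j hj _ hy) rfl⟩
  have hbond : ∀ {j : ℕ} {y : Site P j}, y ∈ 𝔹 j → (⟨y, ⟨0, P.hd⟩⟩ : PBond P j) ∈ bondsOf (𝔹 j) := fun hy => Or.inl hy
  intro b
  obtain ⟨j, y, hj, hy, hφt⟩ := htop b.tgt
  obtain ⟨j', y', hj', hy', hφs⟩ := htop b.src
  rw [hφt, hφs, sub_eq_zero]
  exact hconn φ hconst j j' hj hj' _ (hbond hy) _ (hbond hy')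

end Transversal

/-! ## §3 At NODE 00's objects: (β)♭ for a general determining set in print's `𝐁`-adapted gauge, modulo (L), (Cov), (C) -/

section NodeZero

variable {F : T4Family} {N : ℕ} [NeZero N] {K k : ℕ}

/-- ★★★ **`hnd` AT NODE 00's FLAT MULTI-SCALE CHART FOR A GENERAL DETERMINING SET, IN PRINT's `𝐁`-ADAPTED HIERARCHICAL AXIAL GAUGE, MODULO THE GEOMETRIC LETTERS (L), (Cov), (C)**: `X` hierarchically
axial (for every member site `y ∈ Γ_j`, `j ≤ k`, the `m`-fold linearised averages `Q^{(m)}↑X`, `m < j`, are one-level comb-axial at the sites under `y`), `DΦ(0)X = 0`, `d²∕ds² A(e^{sX})|₀ = 0` ⟹ `X = 0`.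
[cite: Balaban1989LargeFieldII, (1.9) p.358, p.359; Balaban1985RegularSpaces, (1.19) p.79; Balaban1988Convergent, (2.2) p.255, (2.13) pp.256-257] -/
theorem eq_zero_of_fderiv_msChart_one_eq_zero_of_hierAxial_detSet (hk : k ≤ (F.P K).m + (F.P K).K)
    (Q : (i : ℕ) → (PBond (F.P K) 0 → Matrix (Fin N) (Fin N) ℂ) → PBond (F.P K) i → Matrix (Fin N) (Fin N) ℂ)
    (hQ0 : ∀ Y, Q 0 Y = Y) (hQs : ∀ (i : ℕ) (Y : PBond (F.P K) 0 → Matrix (Fin N) (Fin N) ℂ) (c : PBond (F.P K) (i + 1)), Q (i + 1) Y c = linAvg (Q i Y) c)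
    (𝔹 : DetSet (F.P K))
    (hloop : ∀ μ : Fin (F.P K).d, ∃ (j : ℕ) (R : Finset (Site (F.P K) j)), j ≤ k ∧ R.Nonempty ∧ (∀ y ∈ R, y.shift μ ∈ R) ∧
      ∀ y ∈ R, (⟨y, μ⟩ : PBond (F.P K) j) ∈ bondsOf (𝔹 j))
    (hcov : ∀ z : Site (F.P K) 0, ∃ j, j ≤ k ∧ iterBlockOf j z ∈ 𝔹 j)
    (hconn : ∀ ψ : Site (F.P K) 0 → Matrix (Fin N) (Fin N) ℂ, (∀ j, j ≤ k → ∀ c ∈ bondsOf (𝔹 j), ψ (embIter j c.tgt) = ψ (embIter j c.src)) →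
      ∀ j j', j ≤ k → j' ≤ k → ∀ c ∈ bondsOf (𝔹 j), ∀ c' ∈ bondsOf (𝔹 j'), ψ (embIter j c.src) = ψ (embIter j' c'.src))
    {X : PBond (F.P K) 0 → lieSU (Fin N)}
    (hax : ∀ j, j ≤ k → ∀ y ∈ 𝔹 j, ∀ m, m < j → ∀ x : Site (F.P K) m, iterBlockOf j (embIter m x) = y →
      axialT (fun b : PBond (F.P K) m => Multiplicative.ofAdd (Q m (fun e => (X e : Matrix (Fin N) (Fin N) ℂ)) b)) (emb (blockOf x)) x = 1)
    (hker : fderiv ℝ (msChart F N K k 𝔹 (avgFamily (avOfRecord F N K) (1 : GaugeField (F.P K) 0 (SU N))) (1 : GaugeField (F.P K) 0 (SU N))) 0 X = 0)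
    (hflat : deriv (deriv fun s : ℝ => wilsonAction4 (expChart (1 : GaugeField (F.P K) 0 (SU N)) (s • X))) 0 = 0) :
    X = 0 := by
  have hS : ∀ φ : Site (F.P K) 0 → lieSU (Fin N), (∀ j, j ≤ k → ∀ c ∈ bondsOf (𝔹 j), φ (embIter j c.tgt) = φ (embIter j c.src)) →
      (fun b : PBond (F.P K) 0 => φ b.tgt - φ b.src) ∈
        {Y : PBond (F.P K) 0 → lieSU (Fin N) | ∀ j, j ≤ k → ∀ y ∈ 𝔹 j, ∀ m, m < j → ∀ x : Site (F.P K) m, iterBlockOf j (embIter m x) = y →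
          axialT (fun b : PBond (F.P K) m => Multiplicative.ofAdd (Q m (fun e => (Y e : Matrix (Fin N) (Fin N) ℂ)) b)) (emb (blockOf x)) x = 1} →
      ∀ b : PBond (F.P K) 0, φ b.tgt - φ b.src = 0 := by
    intro φ hφ hmem b
    have hmat := grad_eq_zero_of_hierAxial_of_locConst Q hQ0 hQs hk 𝔹 hcov hconn (fun z => (φ z : Matrix (Fin N) (Fin N) ℂ))
      (fun j hj c hc => by rw [hφ j hj c hc]) (fun j hj y hy m hm x hx => by
        have h := hmem j hj y hy m hm x hx
        simp only [Submodule.coe_sub] at h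
        exact h) b
    exact Subtype.ext (by rw [Submodule.coe_sub, hmat, ZeroMemClass.coe_zero])
  exact eq_zero_of_fderiv_msChart_one_eq_zero_of_transversal_detSet 𝔹 hloop hS hax hker hflat

/-- ★★ **POSITIVITY FORM**, general determining set, `𝐁`-adapted hierarchical axial gauge, modulo (L), (Cov), (C): `X ≠ 0` ⟹ `0 < d²∕ds² A(e^{sX})|₀`.
[cite: Balaban1989LargeFieldII, (1.9) p.358, p.359; Balaban1985RegularSpaces, (1.19) p.79] -/
theorem deriv_deriv_pos_of_fderiv_msChart_one_eq_zero_of_hierAxial_detSet (hk : k ≤ (F.P K).m + (F.P K).K)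
    (Q : (i : ℕ) → (PBond (F.P K) 0 → Matrix (Fin N) (Fin N) ℂ) → PBond (F.P K) i → Matrix (Fin N) (Fin N) ℂ)
    (hQ0 : ∀ Y, Q 0 Y = Y) (hQs : ∀ (i : ℕ) (Y : PBond (F.P K) 0 → Matrix (Fin N) (Fin N) ℂ) (c : PBond (F.P K) (i + 1)), Q (i + 1) Y c = linAvg (Q i Y) c)
    (𝔹 : DetSet (F.P K))
    (hloop : ∀ μ : Fin (F.P K).d, ∃ (j : ℕ) (R : Finset (Site (F.P K) j)), j ≤ k ∧ R.Nonempty ∧ (∀ y ∈ R, y.shift μ ∈ R) ∧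
      ∀ y ∈ R, (⟨y, μ⟩ : PBond (F.P K) j) ∈ bondsOf (𝔹 j))
    (hcov : ∀ z : Site (F.P K) 0, ∃ j, j ≤ k ∧ iterBlockOf j z ∈ 𝔹 j)
    (hconn : ∀ ψ : Site (F.P K) 0 → Matrix (Fin N) (Fin N) ℂ, (∀ j, j ≤ k → ∀ c ∈ bondsOf (𝔹 j), ψ (embIter j c.tgt) = ψ (embIter j c.src)) →
      ∀ j j', j ≤ k → j' ≤ k → ∀ c ∈ bondsOf (𝔹 j), ∀ c' ∈ bondsOf (𝔹 j'), ψ (embIter j c.src) = ψ (embIter j' c'.src))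
    {X : PBond (F.P K) 0 → lieSU (Fin N)} (hX0 : X ≠ 0)
    (hax : ∀ j, j ≤ k → ∀ y ∈ 𝔹 j, ∀ m, m < j → ∀ x : Site (F.P K) m, iterBlockOf j (embIter m x) = y →
      axialT (fun b : PBond (F.P K) m => Multiplicative.ofAdd (Q m (fun e => (X e : Matrix (Fin N) (Fin N) ℂ)) b)) (emb (blockOf x)) x = 1)
    (hker : fderiv ℝ (msChart F N K k 𝔹 (avgFamily (avOfRecord F N K) (1 : GaugeField (F.P K) 0 (SU N))) (1 : GaugeField (F.P K) 0 (SU N))) 0 X = 0) :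
    0 < deriv (deriv fun s : ℝ => wilsonAction4 (expChart (1 : GaugeField (F.P K) 0 (SU N)) (s • X))) 0 :=
  lt_of_le_of_ne (deriv_deriv_wilsonAction4_expChart_one_nonneg X) fun h =>
    hX0 (eq_zero_of_fderiv_msChart_one_eq_zero_of_hierAxial_detSet hk Q hQ0 hQs 𝔹 hloop hcov hconn hax hker h.symm)

end NodeZero

/-! ## §5 Sanity instance: the whole-lattice constraint `atScale k` satisfies (F) and (Cov) -/

section AtScale

open B5Eq118OneStroke (iterBlockOf)
open Literature.MathematicalPhysics.QuantumFieldTheory.BalabanImbrieJaffe1984to88.BIJ88RT51Background (iterBlockOf_embIter)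

variable {P : Params}

/-- **(F) for `atScale k`** (`k ≤ m + K`): the face between the `k`-blocks `w` and `w + e_μ` is crossed by the constrained level-`k` bond `⟨w, μ⟩` itself.
[cite: Balaban1985Variational, (5) p.278; Balaban1988Convergent, (2.2) p.255] -/
theorem hface_atScale {k : ℕ} (hk : k ≤ P.m + P.K) (w : Site P k) (μ : Fin P.d) :
    ∃ (j : ℕ) (c : PBond P j), j ≤ k ∧ c ∈ bondsOf ((atScale k : DetSet P) j) ∧
      iterBlockOf k (embIter j c.src) = w ∧ iterBlockOf k (embIter j c.tgt) = w.shift μ :=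
  ⟨k, ⟨w, μ⟩, le_rfl, by simp [atScale, bondsOf], iterBlockOf_embIter k hk w, iterBlockOf_embIter k hk (w.shift μ)⟩

/-- **(Cov) for `atScale k`**: every fine site lies under the level-`k` member `iterBlockOf k z ∈ T^{(k)} = Γ_k`. [cite: Balaban1985Variational, (5) p.278] -/
theorem hcov_atScale (k : ℕ) (z : Site P 0) : ∃ j, j ≤ k ∧ iterBlockOf j z ∈ (atScale k : DetSet P) j :=
  ⟨k, le_rfl, by simp [atScale]⟩

end AtScale


end Summit.QuantumFields.YangMills.BalabanUVNodes.N12FlatHierAxialHndDetSet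

end
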